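import Summits.BirchSwinnertonDyer.Rank1Residual.O5.CompanionTypeLawThreeOfModThreeTransport
import Summits.BirchSwinnertonDyer.Rank1Residual.O5.CongruentCompanionIrreducible
import Summits.BirchSwinnertonDyer.Rank1Residual.O5.O5KummerLineLocalSign
import Literature.NumberTheory.EllipticCurves.ModPCongruenceIsomorphismProofs
import Literature.NumberTheory.EllipticCurves.LocalKummerIsotropyTransport
import HarnessLib

/-!
# O5 G3-2 `CompanionTypeLawThree` is a THEOREM: the Brauer–Nesbitt–Chebotarev transport `hBNC`
# (`IsCompanionAtThree W G ⟹ G[3] ≅ W[3]` for irreducible `W[3]`) discharged, and the local step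
# `hloc` of `kummerLineByLocalRootNumberThree_of_rel` (cell `b2b-bsdres`, lane CLASS-CLOSURE,
# class O5; harvest seat 2, GEN 54, E109)

HONEST FRAMING (cell `b2b-bsdres`, run/shared/lean/b2b/bsd-rank1-residual/, verbatim in every
file): the goal of the cell is to DELETE the COMBINATION-SHAPED residual classes of the
Birch–Swinnerton-Dyer formula for ALL analytic-rank `≤ 1` elliptic curves over `ℚ` — "full BSD
formula for every rank `≤ 1` curve in class `C`" assembled STRICTLY from published theorems — so
that the rank-`≤ 1` remainder becomes exactly the CONSTRUCTION-SHAPED classes, which are TYPED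
(missing-input `Prop`s), NOT attempted. This is not "finishing BSD". Lane CLASS-CLOSURE: research
routes; no claim beyond the stated classes; nothing is booked here; no mark of `RESIDUAL-MAP.md`
moves; census numbers are EVIDENCE. THEOREMS ONLY (no definition, no named fact, no conjecture node;
net named-fact debt `0`); no node file is touched; O5 stays OPEN; the restamp of the node
`CompanionTypeLawThree` (THEOREM-CANDIDATE ↦ THEOREM) is the typers' pen.

## What this file does

`O5/CompanionTypeLawThreeOfModThreeTransport.lean` (x11b3-p4 GEN 14) derived the O5 node G3-2
`CompanionTypeLawThree` (`O5/O5CompanionTransport.lean`: for `W ∈ O5b` with `ρ̄_{W,3}` irreducible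
and an elliptic companion `G` semistable at `3`, `3 ∣ a₃(G) ↔ LocIrr W 3`) from ONE labelled
binder `hBNC` — the Brauer–Nesbitt–Chebotarev transport "`IsCompanionAtThree W G` with `ρ̄_{W,3}`
irreducible gives a `Gal(ℚ̄/ℚ)`-equivariant `G[3] ≅ W[3]`" (Darmon–Diamond–Taylor 1995, Prop. 2.6 (b)
with Prop. 2.8 (a), Prop. 2.11 (a)), recorded there as a HYPOTHESIS because "Mathlib has neither
Chebotarev nor Brauer–Nesbitt for Galois representations".  Both are tree theorems now
(`GaloisRepresentations.chebotarevArtinRep_holds`, `GaloisRepresentations.brauerNesbitt_holds`), and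
the transport is the Literature theorem
`Literature.NumberTheory.EllipticCurves.exists_addEquiv_geomTorsion_of_frobeniusTrace_congr_off_finite`
(`Literature/…/ModPCongruenceIsomorphismProofs.lean`, harvest-2 GEN 54: joint Chebotarev for
`ℚ(W[p], G[p])`, `tr`/`det` of Frobenius on `E[p]`, Brauer–Nesbitt over `𝔽_p`).  Hence:

* `exists_addEquiv_geomTorsion_of_isCongruentModThree` — `Irr W 3 → IsCongruentModThree W G →
  ∃ e : G[3] ≃+ W[3], ∀ σ P, e (σ • P) = σ • e P` (the O5 spelling; `S = {ℓ ≤ 3 N_W N_G}` via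
  `frobeniusTrace_congr_of_isCongruentModThree`), and the symmetric `W[3] ≃+ G[3]`;
* `isCompanionThree_of_isCongruentModThree` — the O6 bridge: good at `3` + `Irr W 3` +
  `IsCongruentModThree W A` ⟹ `Additive.IsCompanionThree W A`;
* `modThreeTransport_of_isCompanionAtThree` — exactly the binder `hBNC`, as a theorem;
* **`companionTypeLawThree_holds : CompanionTypeLawThree`** — the node, unconditionally
  (`companionTypeLawThree_of_modThreeTransport modThreeTransport_of_isCompanionAtThree`);
* the LOCAL step `hloc` of `kummerLineByLocalRootNumberThree_of_rel` (`O5/O5KummerLineLocalSign.lean`,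
  cc-typer-5 GEN 11: "`W[3]` irreducible + congruence ⟹ `W[3] ≅ X[3]` as `Γ_ℚ`-modules ⟹ as
  `G_{ℚ₃}`-modules — a hypothesis schema here") as a theorem:
  `isLocallyCongruentModThreeAt3_of_equivariant` (restriction to the decomposition group at `3` via
  the tree's torsion transfers `torsionTransferEquiv`, `LocalKummerIsotropyTransport.lean`, exactly as
  in `Additive.locIrr_iff_of_equivariant`), `isLocallyCongruentModThreeAt3_of_isCongruentModThree`,
  and **`kummerLineByLocalRootNumberThree_of_relKummerLineThreeCongruent :
  RelKummerLineThreeCongruent → KummerLineByLocalRootNumberThree`** — T24ℓ follows from A-O5-30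
  ALONE (both remain `@[conjecture]` nodes; nothing about either is asserted).

Together with E107 (`O5/CongruentCompanionTorsion.lean`: no rational `3`-torsion on either member)
and E108 (`O5/CongruentCompanionIrreducible.lean`: `Irr G 3`) this completes the kernel form of the
docstring parenthetical of `IsCongruentModThree` / `IsCompanionAtThree` ("so `ρ̄_W^{ss} ≅ ρ̄_X^{ss}`
by Brauer–Nesbitt–Chebotarev, and `ρ̄_W ≅ ρ̄_X` when `ρ̄_W` is irreducible").

References: H. Darmon, F. Diamond, R. Taylor, *Fermat's Last Theorem* (1995) Prop. 2.6 (b), 2.8 (a),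
2.11 (a) [DarmonDiamondTaylor1995]; N. Bourbaki, *Algèbre* VIII §20 n°6 Cor. 1
[BourbakiAlgebreVIII2012]; J.-P. Serre, Invent. Math. 15 (1972) §1.11 Prop. 11–12 [Serre1972]; cell:
`O5/O5CompanionTransport.lean`, `O5/CompanionTypeLawThreeOfModThreeTransport.lean`,
`O5/CongruentCompanionTorsion.lean`, `O5/CongruentCompanionIrreducible.lean`,
HOME/b2b-bsdres-harvest-2/gen54/E109.
-/

set_option autoImplicit false

noncomputable section

open WeierstrassCurve Literature.NumberTheory.EllipticCurves

namespace Summit.BirchSwinnertonDyer.Rank1Residual.O5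

section Pair

variable (W G : WeierstrassCurve ℚ) [W.IsElliptic] [W.IsGloballyMinimal] [G.IsElliptic]
  [G.IsGloballyMinimal]

/-- **`ρ̄_{G,3} ≅ ρ̄_{W,3}` along a mod-3 congruence with `W[3]` irreducible** (`IsCongruentModThree
W G`: `a_ℓ(W) ≡ a_ℓ(G) (mod 3)` at every prime `ℓ ∤ 3 N_W N_G`): a `Gal(ℚ̄/ℚ)`-equivariant additive
isomorphism `G[3] ≃+ W[3]` (the Literature theorem
`exists_addEquiv_geomTorsion_of_frobeniusTrace_congr_off_finite` with `S = {ℓ ≤ 3 N_W N_G}` and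
`frobeniusTrace_congr_of_isCongruentModThree`).
[cite: DarmonDiamondTaylor1995, Prop. 2.6 (b), Prop. 2.8 (a), Prop. 2.11 (a) (PDF pp. 53–57)] -/
theorem exists_addEquiv_geomTorsion_of_isCongruentModThree (hirr : W.HasIrreducibleModPGaloisRep 3)
    (hcong : IsCongruentModThree W G) :
    ∃ e : geomTorsion G (3 : ℤ) ≃+ geomTorsion W (3 : ℤ),
      ∀ (σ : Field.absoluteGaloisGroup ℚ) (P : geomTorsion G (3 : ℤ)), e (σ • P) = σ • e P :=
  exists_addEquiv_geomTorsion_of_frobeniusTrace_congr_off_finite W G 3 hirr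
    {ℓ | ℓ ≤ 3 * W.conductorNorm ℤ * G.conductorNorm ℤ} (Set.finite_le_nat _)
    (fun ℓ _ hℓS hgW hgG ↦ by
      have h3 := frobeniusTrace_congr_of_isCongruentModThree W G hcong ℓ hℓS hgW hgG
      rwa [Nat.cast_ofNat])

/-- Symmetric spelling: an equivariant `W[3] ≃+ G[3]` along a mod-3 congruence with `W[3]`
irreducible. [cite: DarmonDiamondTaylor1995, Prop. 2.6 (b) (PDF p. 53)] -/
theorem exists_addEquiv_geomTorsion_of_isCongruentModThree' (hirr : W.HasIrreducibleModPGaloisRep 3)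
    (hcong : IsCongruentModThree W G) :
    ∃ e : geomTorsion W (3 : ℤ) ≃+ geomTorsion G (3 : ℤ),
      ∀ (σ : Field.absoluteGaloisGroup ℚ) (P : geomTorsion W (3 : ℤ)), e (σ • P) = σ • e P :=
  exists_addEquiv_geomTorsion_of_frobeniusTrace_congr_off_finite' W G 3 hirr
    {ℓ | ℓ ≤ 3 * W.conductorNorm ℤ * G.conductorNorm ℤ} (Set.finite_le_nat _)
    (fun ℓ _ hℓS hgW hgG ↦ by
      have h3 := frobeniusTrace_congr_of_isCongruentModThree W G hcong ℓ hℓS hgW hgG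
      rwa [Nat.cast_ofNat])

/-- **A semistable companion at `3` of a curve with irreducible `W[3]` has `G[3] ≅ W[3]`**
(`IsCompanionAtThree W G` = `9 ∤ N_G` and the mod-3 congruence).
[cite: DarmonDiamondTaylor1995, Prop. 2.6 (b) (PDF p. 53)] -/
theorem exists_addEquiv_geomTorsion_of_isCompanionAtThree (hirr : W.HasIrreducibleModPGaloisRep 3)
    (hcomp : IsCompanionAtThree W G) :
    ∃ e : geomTorsion G (3 : ℤ) ≃+ geomTorsion W (3 : ℤ),
      ∀ (σ : Field.absoluteGaloisGroup ℚ) (P : geomTorsion G (3 : ℤ)), e (σ • P) = σ • e P :=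
  exists_addEquiv_geomTorsion_of_isCongruentModThree W G hirr hcomp.2

/-- **O6 bridge**: a curve `A` with GOOD reduction at `3`, congruent to `W` mod `3` in the census
sense (`IsCongruentModThree W A`), is a COMPANION of `W` in the O6 sense
(`Additive.IsCompanionThree W A`: good at `3` and a `Gal(ℚ̄/ℚ)`-equivariant `A[3] ≃+ W[3]`) as soon
as `W[3]` is irreducible — the docstring's "for irreducible `W[3]` a full trace congruence gives the
isomorphism by Brauer–Nesbitt + Chebotarev" (`Additive/ShaGrowthDichotomyThree.lean` §3) as a theorem.
[cite: DarmonDiamondTaylor1995, Prop. 2.6 (b) (PDF p. 53)] -/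
theorem isCompanionThree_of_isCongruentModThree (hgood : G.HasGoodReductionAtPrime 3)
    (hirr : W.HasIrreducibleModPGaloisRep 3) (hcong : IsCongruentModThree W G) :
    Summit.BirchSwinnertonDyer.Rank1Residual.Additive.IsCompanionThree W G :=
  ⟨hgood, exists_addEquiv_geomTorsion_of_isCongruentModThree W G hirr hcong⟩

end Pair

/-! ## The binder `hBNC` and the node -/

/-- **The Brauer–Nesbitt–Chebotarev transport `hBNC` of
`companionTypeLawThree_of_modThreeTransport`, as a theorem**: for globally minimal elliptic
`W, G / ℚ` with `ρ̄_{W,3}` irreducible and `G` a semistable companion of `W` at `3`, a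
`Gal(ℚ̄/ℚ)`-equivariant `G[3] ≃+ W[3]`.
[cite: DarmonDiamondTaylor1995, Prop. 2.6 (b), Prop. 2.8 (a), Prop. 2.11 (a) (PDF pp. 53–57)] -/
theorem modThreeTransport_of_isCompanionAtThree :
    ∀ (W G : WeierstrassCurve ℚ) [W.IsElliptic] [W.IsGloballyMinimal] [G.IsElliptic]
      [G.IsGloballyMinimal], W.HasIrreducibleModPGaloisRep 3 → IsCompanionAtThree W G →
        ∃ e : geomTorsion G (3 : ℤ) ≃+ geomTorsion W (3 : ℤ),
          ∀ (σ : Field.absoluteGaloisGroup ℚ) (P : geomTorsion G (3 : ℤ)), e (σ • P) = σ • e P :=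
  fun W G _ _ _ _ hirr hcomp ↦ exists_addEquiv_geomTorsion_of_isCompanionAtThree W G hirr hcomp

/-- **O5 G3-2 `CompanionTypeLawThree` holds** (THEOREM-CANDIDATE ↦ THEOREM): an elliptic companion
`G` of an O5b curve `W` with `ρ̄_{W,3}` irreducible, semistable at `3`, has `3 ∣ a₃(G)` iff
`W[3]|G_{ℚ₃}` is irreducible — `companionTypeLawThree_of_modThreeTransport` (x11b3-p4 GEN 14: the
local half at a semistable `3`, Serre 1972 §1.11 Prop. 11–12, and `LocIrr` as a function of the
`Γ_ℚ`-module `E[3]`) fed with `modThreeTransport_of_isCompanionAtThree`.  The binders `ClassO5 W 3`,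
`SubTprime W 3` of the node are not used.  Nothing about any particular curve is asserted; no pair
is closed; no mark moves.
[cite: DarmonDiamondTaylor1995, Prop. 2.6 (b), Prop. 2.8 (a), Prop. 2.11 (a) (PDF pp. 53–57)]
[cite: Serre1972, §1.11 Prop. 11–12] -/
theorem companionTypeLawThree_holds : CompanionTypeLawThree :=
  companionTypeLawThree_of_modThreeTransport modThreeTransport_of_isCompanionAtThree

/-! ## The local step `hloc` of `kummerLineByLocalRootNumberThree_of_rel` -/

section LocalStep

variable (W X : WeierstrassCurve ℚ) [W.IsElliptic] [X.IsElliptic]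

/-- **Restriction to the decomposition group at `3`**: a `Gal(ℚ̄/ℚ)`-equivariant `W[3] ≃+ X[3]`
gives a `Gal(ℚ̄₃/ℚ₃)`-equivariant `(W⁄ℚ₃)[3] ≃+ (X⁄ℚ₃)[3]` (`IsLocallyCongruentModThreeAt3 W X`), by
conjugating with the tree's torsion transfers `E[3](ℚ̄) ≃+ (E⁄ℚ₃)[3](ℚ̄₃)` (`torsionTransferEquiv`,
equivariant along `absGaloisRestrict ℚ ℚ_[3] : Γ_{ℚ₃} → Γ_ℚ`; the composition of
`Additive.locIrr_iff_of_equivariant`). [cite: SilvermanAEC2009, III.§7 (the representation on E[m])] -/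
theorem isLocallyCongruentModThreeAt3_of_equivariant (e : geomTorsion W (3 : ℤ) ≃+ geomTorsion X (3 : ℤ))
    (he : ∀ (σ : Field.absoluteGaloisGroup ℚ) (P : geomTorsion W (3 : ℤ)), e (σ • P) = σ • e P) :
    IsLocallyCongruentModThreeAt3 W X := by
  have h30 : (3 : ℤ) ≠ 0 := by norm_num
  let tW := W.torsionTransferEquiv (E := ℚ_[3]) h30
  let tX := X.torsionTransferEquiv (E := ℚ_[3]) h30
  refine ⟨(tW.symm.trans e).trans tX, fun σ S ↦ ?_⟩
  change tX (e (tW.symm (σ • S))) = σ • tX (e (tW.symm S))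
  rw [W.torsionTransferEquiv_symm_smul (E := ℚ_[3]) h30 σ S, he,
    X.torsionTransferEquiv_smul (E := ℚ_[3]) h30 σ]

variable [W.IsGloballyMinimal] [X.IsGloballyMinimal]

/-- **`hloc` as a theorem**: `W[3]` irreducible and `IsCongruentModThree W X` give
`IsLocallyCongruentModThreeAt3 W X` (`W[3] ≅ X[3]` as `G_{ℚ₃}`-modules) — Brauer–Nesbitt–Chebotarev
(`exists_addEquiv_geomTorsion_of_isCongruentModThree'`) followed by restriction to `G_{ℚ₃}`.
[cite: DarmonDiamondTaylor1995, Prop. 2.6 (b), Prop. 2.8 (a), Prop. 2.11 (a) (PDF pp. 53–57)] -/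
theorem isLocallyCongruentModThreeAt3_of_isCongruentModThree (hirr : W.HasIrreducibleModPGaloisRep 3)
    (hcong : IsCongruentModThree W X) : IsLocallyCongruentModThreeAt3 W X := by
  obtain ⟨e, he⟩ := exists_addEquiv_geomTorsion_of_isCongruentModThree' W X hirr hcong
  exact isLocallyCongruentModThreeAt3_of_equivariant W X e he

end LocalStep

/-- **T24ℓ `KummerLineByLocalRootNumberThree` follows from A-O5-30 `RelKummerLineThreeCongruent`
ALONE**: the bridge `kummerLineByLocalRootNumberThree_of_rel` (cc-typer-5 GEN 11, PROVED bookkeeping)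
with its congruence-to-local-isomorphism schema `hloc` discharged by
`isLocallyCongruentModThreeAt3_of_isCongruentModThree`.  Both nodes remain `@[conjecture]`
(ANNOUNCED antecedent BKNO 2025 Thm. 1.7); nothing about either is asserted here.
[cite: DarmonDiamondTaylor1995, Prop. 2.6 (b) (PDF p. 53)] -/
theorem kummerLineByLocalRootNumberThree_of_relKummerLineThreeCongruent
    (hrel : RelKummerLineThreeCongruent) : KummerLineByLocalRootNumberThree :=
  kummerLineByLocalRootNumberThree_of_rel hrel fun W X _ _ _ _ hirr hcong ↦
    isLocallyCongruentModThreeAt3_of_isCongruentModThree W X hirr hcong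

end Summit.BirchSwinnertonDyer.Rank1Residual.O5

end
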